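import Literature.Probability.RandomPlanarGeometry.LoewnerDescriptionProofs
import HarnessLib

/-!
# Curves at reparametrisation distance zero: an order-preserving correspondence of sub-arcs
(input (T3) of `PercFaceAnnulusTransfer`, continuum–lattice bridge)

Crux `Summit.CriticalPhenomena.CardyFormulaZ2.Theses.CardyUniqueLimit.CardyRigidity`
(stmt-CriticalPhenomena-0746), line `crossing_martingale`, stub A2‴ `stub_percFaceAnnulusTransfer :
Driver.PercFaceAnnulusTransfer` (`…FaceHalfPlaneG2OfTransfer.lean`).  In (T2)/(T3) the interface is
known only as a curve CLASS: the class of the exploration polyline `P` equals the class of the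
compactified image `c' = Φ_k ∘ γ̂` of the Loewner trace, i.e. `dist P c' = 0` for the reparametrisation
pseudo-distance — which does NOT provide a reparametrisation carrying one onto the other, only a
sequence of `εₙ`-close ones.  The tree's `Curve.exists_image_Iic_eq_of_dist_eq_zero` extracts from it
the equality of the families of INITIAL-segment traces (whence capacity times of prefixes).  The
lattice arguments of (T3) need more: the piece of `γ̂` between two consecutive capacity times is mapped
onto the corresponding medial EDGE, and the trace at a capacity time is the last explored medial
vertex.  This file proves the underlying elementary fact:

* `Order.image_Icc_eq_of_tendsto` — along `εₖ`-close reparametrisations `Ψₖ` (`εₖ → 0`) with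
  `Ψₖ a → sa`, `Ψₖ b → sb` (`a ≤ b`), the sub-arcs correspond: `γ[a, b] = γ'[sa, sb]`;
* **`Order.exists_correspondence_of_dist_eq_zero`** — if `dist γ γ' = 0` and `r ≤ r'`, there are
  `s ≤ s'` with `γ r = γ' s`, `γ r' = γ' s'`, `γ[0, r] = γ'[0, s]`, `γ[r, r'] = γ'[s, s']` and
  `γ[r', 1] = γ'[s', 1]` (joint subsequential limits of `ψₙ r`, `ψₙ r'` for reparametrisations `ψₙ`
  realising distance `< 1/(n+1)`; Bolzano–Weierstrass on `[0, 1]²`).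

References: M. Aizenman, A. Burchard, Duke Math. J. 99 (1999), §2.1 (the metric) [AizenmanBurchard1999];
A. Kemppainen, S. Smirnov, Ann. Probab. 45 (2017), §1.2 [KemppainenSmirnov2017].
-/

noncomputable section

open Set Metric Filter Topology
open scoped unitInterval
open Literature.Probability.RandomPlanarGeometry

namespace Summit.CriticalPhenomena.CardyFormulaZ2.Cruxes.CardyRigidity.CrossingMartingale

namespace Order

variable {E : Type*} [MetricSpace E] {γ γ' : Curve E}

/-- **Sub-arcs correspond along close reparametrisations.**  Let `Ψₖ` be increasing
self-homeomorphisms of `[0, 1]` with `dist (γ t) (γ' (Ψₖ t)) ≤ εₖ → 0` uniformly in `t`, and let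
`Ψₖ a → sa`, `Ψₖ b → sb` with `a ≤ b`.  Then `γ[a, b] = γ'[sa, sb]`. [cite: AizenmanBurchard1999, §2.1] -/
theorem image_Icc_eq_of_tendsto {Ψ : ℕ → I ≃o I} {ε : ℕ → ℝ}
    (hclose : ∀ k (t : I), dist (γ t) (γ' (Ψ k t)) ≤ ε k) (hε : Tendsto ε atTop (𝓝 0))
    {a b sa sb : I} (hab : a ≤ b) (ha : Tendsto (fun k ↦ Ψ k a) atTop (𝓝 sa))
    (hb : Tendsto (fun k ↦ Ψ k b) atTop (𝓝 sb)) :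
    (γ : I → E) '' Icc a b = (γ' : I → E) '' Icc sa sb := by
  have hγc : Continuous γ := γ.continuous
  have hγ'c : Continuous γ' := γ'.continuous
  have hrate : ∀ {θ : ℕ → ℕ}, StrictMono θ → Tendsto (fun k ↦ ε (θ k)) atTop (𝓝 0) :=
    fun {θ} hθ ↦ hε.comp hθ.tendsto_atTop
  refine Subset.antisymm ?_ ?_
  · rintro _ ⟨t, ht, rfl⟩
    obtain ⟨ρ, θ, hθ, hρ⟩ := CompactSpace.tendsto_subseq fun k ↦ Ψ k t
    have h1 : sa ≤ ρ :=
      le_of_tendsto_of_tendsto' (ha.comp hθ.tendsto_atTop) hρ fun k ↦ (Ψ (θ k)).monotone ht.1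
    have h2 : ρ ≤ sb :=
      le_of_tendsto_of_tendsto' hρ (hb.comp hθ.tendsto_atTop) fun k ↦ (Ψ (θ k)).monotone ht.2
    refine ⟨ρ, ⟨h1, h2⟩, ?_⟩
    have h3 : Tendsto (fun k ↦ γ' (Ψ (θ k) t)) atTop (𝓝 (γ' ρ)) := (hγ'c.tendsto ρ).comp hρ
    have h4 : Tendsto (fun k ↦ γ' (Ψ (θ k) t)) atTop (𝓝 (γ t)) := by
      refine (tendsto_const_nhds (x := γ t)).congr_dist ?_
      exact squeeze_zero (fun _ ↦ dist_nonneg) (fun k ↦ hclose (θ k) t) (hrate hθ)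
    exact tendsto_nhds_unique h3 h4
  · rintro _ ⟨ρ, hρ, rfl⟩
    -- times in `[a, b]` mapped as close as possible to `ρ`
    set r : ℕ → I := fun k ↦ max a (min b ((Ψ k).symm ρ)) with hr_def
    have hr_mem : ∀ k, r k ∈ Icc a b := fun k ↦ ⟨le_max_left _ _, max_le hab (min_le_left _ _)⟩
    have hΨr : ∀ k, Ψ k (r k) = max (Ψ k a) (min (Ψ k b) ρ) := fun k ↦ by
      rw [hr_def, (Ψ k).monotone.map_max, (Ψ k).monotone.map_min, OrderIso.apply_symm_apply]
    obtain ⟨r₀, θ, hθ, hr₀⟩ := CompactSpace.tendsto_subseq r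
    have hr₀mem : r₀ ∈ Icc a b := isClosed_Icc.mem_of_tendsto hr₀ (Eventually.of_forall fun k ↦ hr_mem _)
    refine ⟨r₀, hr₀mem, ?_⟩
    have h1 : Tendsto (fun k ↦ γ (r (θ k))) atTop (𝓝 (γ r₀)) := (hγc.tendsto r₀).comp hr₀
    have hlim : Tendsto (fun k ↦ Ψ (θ k) (r (θ k))) atTop (𝓝 ρ) := by
      have h3 : Tendsto (fun k ↦ max (Ψ (θ k) a) (min (Ψ (θ k) b) ρ)) atTop
          (𝓝 (max sa (min sb ρ))) :=
        (ha.comp hθ.tendsto_atTop).max ((hb.comp hθ.tendsto_atTop).min tendsto_const_nhds)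
      rw [min_eq_right hρ.2, max_eq_right hρ.1] at h3
      exact h3.congr fun k ↦ (hΨr (θ k)).symm
    have h2 : Tendsto (fun k ↦ γ (r (θ k))) atTop (𝓝 (γ' ρ)) := by
      have h3 : Tendsto (fun k ↦ γ' (Ψ (θ k) (r (θ k)))) atTop (𝓝 (γ' ρ)) :=
        (hγ'c.tendsto ρ).comp hlim
      refine h3.congr_dist (squeeze_zero (fun _ ↦ dist_nonneg) (fun k ↦ ?_) (hrate hθ))
      rw [dist_comm]
      exact hclose (θ k) (r (θ k))
    exact tendsto_nhds_unique h1 h2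

/-- Points correspond along close reparametrisations: if `Ψₖ a → sa` then `γ a = γ' sa`.
[cite: AizenmanBurchard1999, §2.1] -/
theorem apply_eq_of_tendsto {Ψ : ℕ → I ≃o I} {ε : ℕ → ℝ}
    (hclose : ∀ k (t : I), dist (γ t) (γ' (Ψ k t)) ≤ ε k) (hε : Tendsto ε atTop (𝓝 0))
    {a sa : I} (ha : Tendsto (fun k ↦ Ψ k a) atTop (𝓝 sa)) : γ a = γ' sa := by
  have h := image_Icc_eq_of_tendsto hclose hε le_rfl ha ha
  rw [Icc_self, Icc_self, image_singleton, image_singleton, singleton_eq_singleton_iff] at h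
  exact h

/-- **An order-preserving correspondence of sub-arcs for curves at distance zero.**  If
`dist γ γ' = 0` and `r ≤ r'`, there are parameters `s ≤ s'` with `γ r = γ' s`, `γ r' = γ' s'`,
`γ[0, r] = γ'[0, s]`, `γ[r, r'] = γ'[s, s']` and `γ[r', 1] = γ'[s', 1]`.
[cite: AizenmanBurchard1999, §2.1] -/
theorem exists_correspondence_of_dist_eq_zero (h : dist γ γ' = 0) {r r' : I} (hrr' : r ≤ r') :
    ∃ s s' : I, s ≤ s' ∧ γ r = γ' s ∧ γ r' = γ' s' ∧
      (γ : I → E) '' Iic r = (γ' : I → E) '' Iic s ∧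
      (γ : I → E) '' Icc r r' = (γ' : I → E) '' Icc s s' ∧
      (γ : I → E) '' Ici r' = (γ' : I → E) '' Ici s' := by
  -- reparametrisations realising distance `< 1 / (n + 1)`
  have hε : ∀ n : ℕ, dist γ γ' < 1 / ((n : ℝ) + 1) := fun n ↦ by rw [h]; positivity
  choose ψ hψ using fun n ↦ Curve.exists_dist_reparam_lt (hε n)
  have hclose : ∀ n (t : I), dist (γ t) (γ' (ψ n t)) ≤ 1 / ((n : ℝ) + 1) := fun n t ↦ by
    have h1 := ContinuousMap.dist_apply_le_dist (f := γ.toContinuousMap)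
      (g := (γ'.reparam (ψ n)).toContinuousMap) (x := t)
    simp only [Curve.coe_toContinuousMap, Curve.reparam_apply] at h1
    exact h1.trans (hψ n).le
  -- a joint subsequential limit of `(ψ n r, ψ n r')`
  obtain ⟨q, θ, hθ, hq⟩ := CompactSpace.tendsto_subseq fun n ↦ (ψ n r, ψ n r')
  set Ψ : ℕ → I ≃o I := fun k ↦ ψ (θ k) with hΨ
  have hrate : Tendsto (fun k ↦ 1 / ((θ k : ℝ) + 1)) atTop (𝓝 0) :=
    (tendsto_one_div_add_atTop_nhds_zero_nat (𝕜 := ℝ)).comp hθ.tendsto_atTop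
  have hclose' : ∀ k (t : I), dist (γ t) (γ' (Ψ k t)) ≤ 1 / ((θ k : ℝ) + 1) := fun k t ↦ hclose _ t
  have hs : Tendsto (fun k ↦ Ψ k r) atTop (𝓝 q.1) := (continuous_fst.tendsto q).comp hq
  have hs' : Tendsto (fun k ↦ Ψ k r') atTop (𝓝 q.2) := (continuous_snd.tendsto q).comp hq
  have h0 : Tendsto (fun k ↦ Ψ k 0) atTop (𝓝 0) := by
    have : ∀ k, Ψ k 0 = 0 := fun k ↦ (Ψ k).map_bot
    simp only [this]; exact tendsto_const_nhds
  have h1 : Tendsto (fun k ↦ Ψ k 1) atTop (𝓝 1) := by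
    have : ∀ k, Ψ k 1 = 1 := fun k ↦ (Ψ k).map_top
    simp only [this]; exact tendsto_const_nhds
  have hqq : q.1 ≤ q.2 := le_of_tendsto_of_tendsto' hs hs' fun k ↦ (Ψ k).monotone hrr'
  refine ⟨q.1, q.2, hqq, apply_eq_of_tendsto hclose' hrate hs, apply_eq_of_tendsto hclose' hrate hs',
    ?_, image_Icc_eq_of_tendsto hclose' hrate hrr' hs hs', ?_⟩
  · have := image_Icc_eq_of_tendsto hclose' hrate (show (0 : I) ≤ r from r.2.1) h0 hs
    simpa only [Icc_bot, show (0 : I) = ⊥ from rfl] using this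
  · have := image_Icc_eq_of_tendsto hclose' hrate (show r' ≤ (1 : I) from r'.2.2) hs' h1
    simpa only [Icc_top, show (1 : I) = ⊤ from rfl] using this

end Order

/-- **Registered form** (anchor `order_exists_correspondence_of_dist_eq_zero` of stmt-CriticalPhenomena-0746, input (T3) of
`Driver.PercFaceAnnulusTransfer`): an order-preserving correspondence of sub-arcs for curves at reparametrisation
distance zero. [cite: AizenmanBurchard1999, §2.1] -/
theorem order_exists_correspondence_of_dist_eq_zero : ∀ {E : Type*} [MetricSpace E] {γ γ' : Literature.Probability.RandomPlanarGeometry.Curve E}, dist γ γ' = 0 → ∀ {r r' : unitInterval}, r ≤ r' → ∃ s s' : unitInterval, s ≤ s' ∧ γ r = γ' s ∧ γ r' = γ' s' ∧ (γ : unitInterval → E) '' Set.Iic r = (γ' : unitInterval → E) '' Set.Iic s ∧ (γ : unitInterval → E) '' Set.Icc r r' = (γ' : unitInterval → E) '' Set.Icc s s' ∧ (γ : unitInterval → E) '' Set.Ici r' = (γ' : unitInterval → E) '' Set.Ici s' :=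
  fun h _ _ hrr' ↦ Order.exists_correspondence_of_dist_eq_zero h hrr'

end Summit.CriticalPhenomena.CardyFormulaZ2.Cruxes.CardyRigidity.CrossingMartingale

end
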